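import Summits.CriticalPhenomena.PercolationContinuityZ3.Theorems.PercAnnulusCrossingSlabBoxCrossingPropertyAssembly
import Literature.Probability.Percolation.SlabRSWLemma311
import HarnessLib

/-!
# RSW3 lane (lead GEN 37): THE ASSEMBLY OF NEWMAN–TASSION–WU'S THEOREM 3.1 AT `p_c(S_k)`, SECOND HALF — the upper bound
# (3.60) is reduced to the gluing-layer inputs; Theorem 3.1 at `p_c(S_k)` now follows from SIX named inputs, all of them
# statements of NTW's §3.2–3.6 about local surgery (gluing) in the slab

builds on p205010 (kernel theorem, internal audit signed; external expert review pending) — NOT used in this file.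

Cell `prim-rsw3` (LANE 3), lead seat, gen 37.  Support file (`--supports stmt-CriticalPhenomena-4575`); no definitions, no named
facts, no sorries.  Gen 36 (`…SlabBoxCrossingPropertyAssembly`) reduced `NewmanTassionWu2017_thm31` to `(H314)` (NTW's Theorem 3.14
at `p_c(S_k)`, itself reduced to the Case-2/Case-3 inputs `(H2)`, `(H3)` by `NTW17.thm314_of_cases`) and `(H360)` (the upper bound
(3.60) `∃ c₂ > 0, ∀ n ≥ 1, f_{p_c(S_k)}(n,2n) ≤ 1 - c₂`).  Gen 37's Layer 2b (`Literature/…/SlabBlockRenormalisation`,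
`…/SlabAnnulusCircuits`, `…/SlabRSWLemma311`) proves NTW's Lemma 3.11 (finite criterion for `θ > 0`, by a 5-dependent static
renormalisation whose blocks are the minimal open circuits of annuli), Lemma 3.13 (i) and (3.60) MODULO four inputs of the
gluing layer, stated in final form (`NTW17.h360_of`):

* `(H38)`  Theorem 3.8 (gluing of the minimal circuits of two annuli, `ε-δ` form);
* `(H310)` Theorem 3.10 (open circuits in `A_{λn,2λn}` from `f(2n,n-1) ≥ c`);
* `(H39)`  Proposition 3.9 (1) in the high-probability regime (as used in (3.76));
* `(H317)` Theorem 3.17 with the Prop. 3.9 step of §3.7, at `p_c(S_k)`: `sup_n f(n,2n) = 1 ⟹ sup_{n ≥ m₀} f(2n,n-1) = 1`.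

This file puts the two halves together:

* `h360_slabCritical_of` — `(H360)` at `p_c(S_k)` in the inline form consumed by gen 36's assembly, from (H38), (H310), (H39)
  quantified over every `ε > 0` (NTW: "Fix `ε > 0`") and (H317); the window `ε < p_c(S_k) ≤ 1 - ε` is supplied by the tree
  (`0 < p_c(ℤ³) < p_c(S_k) ≤ 1/2`: Aizenman–Grimmett and `Transplant.StairSlabLog.criticalProb_slab_le_half`).
* `boxCrossingProperty_slabCritical_of_gluing` — **NTW's Theorem 3.1 at `p_c(S_k)` from (H2), (H3), (H38), (H310), (H39), (H317)**.
* `NewmanTassionWu2017_thm31_of_gluing` — the named fact from the same six inputs for every `k ≥ 1`.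

What remains for `NewmanTassionWu2017_thm31_holds` is therefore EXACTLY the gluing layer of the port (NTW §3.2 Facts 1–2 in the
high-probability regime and the surgeries of Theorems 3.7/3.8/3.10/3.17, Lemma 3.16 and the exploration step of Case 3).

References: C. M. Newman, V. Tassion, W. Wu, *Critical percolation and the minimal spanning tree in slabs*, Comm. Pure Appl. Math. 70
(2017) = arXiv:1512.09107, §3.4 (Lemmas 3.11–3.13), §3.7 (proof of Theorem 3.1) [NewmanTassionWu2017].
-/

noncomputable section

namespace Summit.CriticalPhenomena.PercolationContinuityZ3.Theorems.Crossing

open MeasureTheory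
open Literature.Probability.Percolation Literature.Probability.LatticeModels
open Literature.Probability.Percolation.NTW17

/-- **(H360) at `p_c(S_k)` from the gluing-layer inputs.**  For `k ≥ 1` and `m₀ ≥ 1`: if (H38), (H310), (H39) hold on
`[ε, 1-ε]` for every `ε > 0`, and (H317) holds at `p_c(S_k)`, then `∃ c₂ > 0, ∀ n ≥ 1, f_{p_c(S_k)}(n, 2n) ≤ 1 - c₂` (NTW (3.60)),
in the inline form of `NewmanTassionWu2017_thm31_of`. [cite: NewmanTassionWu2017, §3.7 eq. (3.60) with Lemmas 3.11, 3.13] -/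
theorem h360_slabCritical_of (k : ℕ) {m₀ : ℕ} (hm₀ : 1 ≤ m₀)
    (h38 : ∀ ε : ℝ, 0 < ε → ∀ η : ℝ, 0 < η → ∃ δ : ℝ, 0 < δ ∧ ∀ p : unitInterval, ε ≤ (p : ℝ) → (p : ℝ) ≤ 1 - ε →
      ∀ m n : ℕ, m₀ ≤ m → m ≤ n → ∀ (z : ℤ × ℤ) (i : Fin 2),
      1 - δ ≤ crossingProb k p (3 * n) (2 * m) →
      1 - δ ≤ (bondPercolation (slabGraph 3 k) p).real (circuitAround k z m n) →
      1 - δ ≤ (bondPercolation (slabGraph 3 k) p).real (circuitAround k (z + coarseShift (3 * n) i) m n) →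
      1 - η ≤ (bondPercolation (slabGraph 3 k) p).real (linkEvent k z m n i))
    (h310 : ∀ ε : ℝ, 0 < ε → ∀ c : ℝ, 0 < c → ∃ lam : ℕ, 1 ≤ lam ∧ ∃ c' : ℝ, 0 < c' ∧ ∀ p : unitInterval,
      ε ≤ (p : ℝ) → (p : ℝ) ≤ 1 - ε → ∀ n : ℕ, m₀ ≤ n → c ≤ crossingProb k p (2 * n) (n - 1) →
      ∀ z : ℤ × ℤ, c' ≤ (bondPercolation (slabGraph 3 k) p).real (circuitAround k z (lam * n) (2 * (lam * n))))
    (h39 : ∀ ε : ℝ, 0 < ε → ∀ η : ℝ, 0 < η → ∀ j : ℕ, 1 ≤ j → ∃ δ : ℝ, 0 < δ ∧ ∀ p : unitInterval,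
      ε ≤ (p : ℝ) → (p : ℝ) ≤ 1 - ε → ∀ m : ℕ, m₀ ≤ m →
      1 - δ ≤ crossingProb k p (2 * m) (m - 1) → 1 - η ≤ crossingProb k p (j * m) (m - 1))
    (h317 : ∀ η : ℝ, 0 < η →
      (∀ δ : ℝ, 0 < δ → ∃ n : ℕ, 1 ≤ n ∧
        1 - δ ≤ crossingProb k (criticalProbIOf (slabGraph 3 k) (slabOrigin 3 k)) n (2 * n)) →
      ∃ n : ℕ, m₀ ≤ n ∧
        1 - η ≤ crossingProb k (criticalProbIOf (slabGraph 3 k) (slabOrigin 3 k)) (2 * n) (n - 1)) :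
    ∃ c₂ : ℝ, 0 < c₂ ∧ ∀ n : ℕ, 1 ≤ n →
      (bondPercolation (slabGraph 3 k) (criticalProbIOf (slabGraph 3 k) (slabOrigin 3 k))).real
        (slabConn k (boxR 0 n 0 (2 * n)) {z | z.1 = 0} {z | z.1 = n}) ≤ 1 - c₂ := by
  -- the window `ε < p_c(S_k) ≤ 1 - ε`
  set pc : ℝ := criticalProb (slabGraph 3 k) (slabOrigin 3 k) with hpc
  have hpos : 0 < pc :=
    (criticalProb_zd_pos 3 (by norm_num)).trans (AizenmanGrimmett1991.criticalProb_zd_lt_criticalProb_slab_of_AG (d := 3) le_rfl k)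
  have hhalf : pc ≤ 1 / 2 := Transplant.StairSlabLog.criticalProb_slab_le_half k
  set ε : ℝ := pc / 2 with hε
  have hε0 : 0 < ε := by rw [hε]; linarith
  have hεc : ε < pc := by rw [hε]; linarith
  have hc1 : pc ≤ 1 - ε := by rw [hε]; linarith
  obtain ⟨c₂, hc₂, h⟩ := h360_of (k := k) hε0 hm₀ hεc hc1 (h38 ε hε0) (h310 ε hε0) (h39 ε hε0) h317
  refine ⟨c₂, hc₂, fun n hn => ?_⟩
  have := h n hn
  rw [crossingProb_eq] at this
  push_cast at this
  exact this

/-- **NTW's Theorem 3.1 at `p_c(S_k)` FROM THE GLUING LAYER ALONE.**  For `k ≥ 1` (and any `m₀ ≥ 1`): given events `𝓑₂ n` with the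
Case-2 input (H2) (GL, Thm 3.7) and the Case-3 input (H3) (exploration + Lemma 3.16) of Theorem 3.14 at `p_c(S_k)`, and the four
inputs (H38), (H310), (H39) (on `[ε, 1-ε]` for every `ε > 0`), (H317) (at `p_c(S_k)`) of Lemma 3.11 / (3.60), the box-crossing
property holds at `p_c(S_k)`. [cite: NewmanTassionWu2017, Theorem 3.1 (§3.7), Theorem 3.14, Lemmas 3.11–3.13] -/
theorem boxCrossingProperty_slabCritical_of_gluing (k : ℕ) (hk : 1 ≤ k) {m₀ : ℕ} (hm₀ : 1 ≤ m₀)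
    (B₂ : ℕ → Set (BondConfig (slab 3 k)))
    (hCase2 : ∀ x : ℝ, 0 < x → ∃ y : ℝ, 0 < y ∧ ∃ n₂ : ℕ, ∀ n : ℕ, n₂ ≤ n →
      x ≤ (bondPercolation (slabGraph 3 k) (criticalProbIOf (slabGraph 3 k) (slabOrigin 3 k))).real (B₂ n) →
      y ≤ (bondPercolation (slabGraph 3 k) (criticalProbIOf (slabGraph 3 k) (slabOrigin 3 k))).real
        (slabConn k (boxR (-(7 * n)) (7 * n) 0 (13 * n - 1)) (sideSeg (7 * n) (5 * n) (13 * n - 1)) (sideSeg (7 * n) 0 (4 * n - 1))))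
    (hCase3 : ∀ x : ℝ, 0 < x → ∃ y : ℝ, 0 < y ∧ ∃ n₃ : ℕ, ∀ n : ℕ, n₃ ≤ n →
      x ≤ (bondPercolation (slabGraph 3 k) (criticalProbIOf (slabGraph 3 k) (slabOrigin 3 k))).real
        ((slabConn k (boxR 0 (7 * n) 0 (8 * n - 1)) {z | z.1 = 0} (sideSeg (7 * n) 0 (4 * n - 1)) ∩
            slabConn k (boxR (-(7 * n)) (7 * n) 0 (13 * n - 1)) {z | z.2 = 0} (sideSeg (7 * n) (5 * n) (13 * n - 1))) ∩
          (slabConn k (boxR (-(7 * n)) (7 * n) 0 (13 * n - 1)) (sideSeg (7 * n) (5 * n) (13 * n - 1))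
            (sideSeg (7 * n) 0 (4 * n - 1)))ᶜ ∩ (B₂ n)ᶜ) →
      y ≤ (bondPercolation (slabGraph 3 k) (criticalProbIOf (slabGraph 3 k) (slabOrigin 3 k))).real
        (slabConn k (boxR 0 (14 * n) 0 (13 * n)) {z | z.1 = 0} {z | z.1 = 14 * n}))
    (h38 : ∀ ε : ℝ, 0 < ε → ∀ η : ℝ, 0 < η → ∃ δ : ℝ, 0 < δ ∧ ∀ p : unitInterval, ε ≤ (p : ℝ) → (p : ℝ) ≤ 1 - ε →
      ∀ m n : ℕ, m₀ ≤ m → m ≤ n → ∀ (z : ℤ × ℤ) (i : Fin 2),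
      1 - δ ≤ crossingProb k p (3 * n) (2 * m) →
      1 - δ ≤ (bondPercolation (slabGraph 3 k) p).real (circuitAround k z m n) →
      1 - δ ≤ (bondPercolation (slabGraph 3 k) p).real (circuitAround k (z + coarseShift (3 * n) i) m n) →
      1 - η ≤ (bondPercolation (slabGraph 3 k) p).real (linkEvent k z m n i))
    (h310 : ∀ ε : ℝ, 0 < ε → ∀ c : ℝ, 0 < c → ∃ lam : ℕ, 1 ≤ lam ∧ ∃ c' : ℝ, 0 < c' ∧ ∀ p : unitInterval,
      ε ≤ (p : ℝ) → (p : ℝ) ≤ 1 - ε → ∀ n : ℕ, m₀ ≤ n → c ≤ crossingProb k p (2 * n) (n - 1) →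
      ∀ z : ℤ × ℤ, c' ≤ (bondPercolation (slabGraph 3 k) p).real (circuitAround k z (lam * n) (2 * (lam * n))))
    (h39 : ∀ ε : ℝ, 0 < ε → ∀ η : ℝ, 0 < η → ∀ j : ℕ, 1 ≤ j → ∃ δ : ℝ, 0 < δ ∧ ∀ p : unitInterval,
      ε ≤ (p : ℝ) → (p : ℝ) ≤ 1 - ε → ∀ m : ℕ, m₀ ≤ m →
      1 - δ ≤ crossingProb k p (2 * m) (m - 1) → 1 - η ≤ crossingProb k p (j * m) (m - 1))
    (h317 : ∀ η : ℝ, 0 < η →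
      (∀ δ : ℝ, 0 < δ → ∃ n : ℕ, 1 ≤ n ∧
        1 - δ ≤ crossingProb k (criticalProbIOf (slabGraph 3 k) (slabOrigin 3 k)) n (2 * n)) →
      ∃ n : ℕ, m₀ ≤ n ∧
        1 - η ≤ crossingProb k (criticalProbIOf (slabGraph 3 k) (slabOrigin 3 k)) (2 * n) (n - 1)) :
    BoxCrossingProperty k (criticalProbIOf (slabGraph 3 k) (slabOrigin 3 k)) :=
  boxCrossingProperty_slabCritical_of_cases k hk B₂ hCase2 hCase3 (h360_slabCritical_of k hm₀ h38 h310 h39 h317)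

/-- **`NewmanTassionWu2017_thm31` FROM THE GLUING LAYER ALONE**: if for every `k ≥ 1` the six inputs (H2), (H3) (at `p_c(S_k)`),
(H38), (H310), (H39) (on `[ε,1-ε]` for every `ε > 0`) and (H317) (at `p_c(S_k)`) hold — each a statement of NTW §3.2–3.6 about
gluing by local surgery in `S_k` — then NTW's Theorem 3.1 holds. [cite: NewmanTassionWu2017, Theorem 3.1 and §3.7] -/
theorem NewmanTassionWu2017_thm31_of_gluing {m₀ : ℕ} (hm₀ : 1 ≤ m₀)
    (B₂ : (k : ℕ) → ℕ → Set (BondConfig (slab 3 k)))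
    (hCase2 : ∀ k : ℕ, 1 ≤ k → ∀ x : ℝ, 0 < x → ∃ y : ℝ, 0 < y ∧ ∃ n₂ : ℕ, ∀ n : ℕ, n₂ ≤ n →
      x ≤ (bondPercolation (slabGraph 3 k) (criticalProbIOf (slabGraph 3 k) (slabOrigin 3 k))).real (B₂ k n) →
      y ≤ (bondPercolation (slabGraph 3 k) (criticalProbIOf (slabGraph 3 k) (slabOrigin 3 k))).real
        (slabConn k (boxR (-(7 * n)) (7 * n) 0 (13 * n - 1)) (sideSeg (7 * n) (5 * n) (13 * n - 1)) (sideSeg (7 * n) 0 (4 * n - 1))))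
    (hCase3 : ∀ k : ℕ, 1 ≤ k → ∀ x : ℝ, 0 < x → ∃ y : ℝ, 0 < y ∧ ∃ n₃ : ℕ, ∀ n : ℕ, n₃ ≤ n →
      x ≤ (bondPercolation (slabGraph 3 k) (criticalProbIOf (slabGraph 3 k) (slabOrigin 3 k))).real
        ((slabConn k (boxR 0 (7 * n) 0 (8 * n - 1)) {z | z.1 = 0} (sideSeg (7 * n) 0 (4 * n - 1)) ∩
            slabConn k (boxR (-(7 * n)) (7 * n) 0 (13 * n - 1)) {z | z.2 = 0} (sideSeg (7 * n) (5 * n) (13 * n - 1))) ∩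
          (slabConn k (boxR (-(7 * n)) (7 * n) 0 (13 * n - 1)) (sideSeg (7 * n) (5 * n) (13 * n - 1))
            (sideSeg (7 * n) 0 (4 * n - 1)))ᶜ ∩ (B₂ k n)ᶜ) →
      y ≤ (bondPercolation (slabGraph 3 k) (criticalProbIOf (slabGraph 3 k) (slabOrigin 3 k))).real
        (slabConn k (boxR 0 (14 * n) 0 (13 * n)) {z | z.1 = 0} {z | z.1 = 14 * n}))
    (h38 : ∀ k : ℕ, 1 ≤ k → ∀ ε : ℝ, 0 < ε → ∀ η : ℝ, 0 < η → ∃ δ : ℝ, 0 < δ ∧ ∀ p : unitInterval,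
      ε ≤ (p : ℝ) → (p : ℝ) ≤ 1 - ε → ∀ m n : ℕ, m₀ ≤ m → m ≤ n → ∀ (z : ℤ × ℤ) (i : Fin 2),
      1 - δ ≤ crossingProb k p (3 * n) (2 * m) →
      1 - δ ≤ (bondPercolation (slabGraph 3 k) p).real (circuitAround k z m n) →
      1 - δ ≤ (bondPercolation (slabGraph 3 k) p).real (circuitAround k (z + coarseShift (3 * n) i) m n) →
      1 - η ≤ (bondPercolation (slabGraph 3 k) p).real (linkEvent k z m n i))
    (h310 : ∀ k : ℕ, 1 ≤ k → ∀ ε : ℝ, 0 < ε → ∀ c : ℝ, 0 < c → ∃ lam : ℕ, 1 ≤ lam ∧ ∃ c' : ℝ, 0 < c' ∧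
      ∀ p : unitInterval, ε ≤ (p : ℝ) → (p : ℝ) ≤ 1 - ε → ∀ n : ℕ, m₀ ≤ n → c ≤ crossingProb k p (2 * n) (n - 1) →
      ∀ z : ℤ × ℤ, c' ≤ (bondPercolation (slabGraph 3 k) p).real (circuitAround k z (lam * n) (2 * (lam * n))))
    (h39 : ∀ k : ℕ, 1 ≤ k → ∀ ε : ℝ, 0 < ε → ∀ η : ℝ, 0 < η → ∀ j : ℕ, 1 ≤ j → ∃ δ : ℝ, 0 < δ ∧ ∀ p : unitInterval,
      ε ≤ (p : ℝ) → (p : ℝ) ≤ 1 - ε → ∀ m : ℕ, m₀ ≤ m →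
      1 - δ ≤ crossingProb k p (2 * m) (m - 1) → 1 - η ≤ crossingProb k p (j * m) (m - 1))
    (h317 : ∀ k : ℕ, 1 ≤ k → ∀ η : ℝ, 0 < η →
      (∀ δ : ℝ, 0 < δ → ∃ n : ℕ, 1 ≤ n ∧
        1 - δ ≤ crossingProb k (criticalProbIOf (slabGraph 3 k) (slabOrigin 3 k)) n (2 * n)) →
      ∃ n : ℕ, m₀ ≤ n ∧
        1 - η ≤ crossingProb k (criticalProbIOf (slabGraph 3 k) (slabOrigin 3 k)) (2 * n) (n - 1)) :
    NewmanTassionWu2017_thm31 :=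
  fun k hk => boxCrossingProperty_slabCritical_of_gluing k hk hm₀ (B₂ k) (hCase2 k hk) (hCase3 k hk)
    (h38 k hk) (h310 k hk) (h39 k hk) (h317 k hk)

end Summit.CriticalPhenomena.PercolationContinuityZ3.Theorems.Crossing

end
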